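import Literature.MathematicalPhysics.QuantumFieldTheory.Balaban1983to89.B9Thm37GlueTorusE123

/-!
# `Balaban1983to89.B9Thm37GlueTorusInv` — the binders `hloc`, `hG`, `hinv` of the one-scale ℓ¹ torus model
# DISCHARGED: Dirichlet local inverses G′_□ (the inverse of Ω₀(□)(Δ_U + M_q)Ω₀(□) on Ω₀(□)) and the global
# inverse G′ from positivity (sibling leaf of `B9Thm37GlueTorusE123`; own lineage pv21; imports
# `B9Thm37GlueTorusE123` only; modifies nothing)

References (bib keys; the tags below cite only these):
* [B9] = `Balaban1985BackgroundPropagators` — T. Bałaban, *Propagators for lattice gauge theories in a background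
  field*, Commun. Math. Phys. 99 (1985) 389–434.
* [4] = `Balaban1984PropagatorsII` — T. Bałaban, *Propagators and renormalization transformations for lattice gauge
  theories. II*, Commun. Math. Phys. 96 (1984) 223–250.
* [3] = `Balaban1984PropagatorsI` — T. Bałaban, *Propagators and renormalization transformations for lattice gauge
  theories. I*, Commun. Math. Phys. 95 (1984) 17–40.

THE PRINTED LOCI.  Certified in the headers of modules this file imports: [B9] p. 394 (verbatim) *"For such Ω₀ we
consider the operator Δ′_a with Dirichlet boundary conditions on ∂Ω₀, i.e. the operator Δ′_a↾_{Ω₀} = Ω₀Δ′_aΩ₀. In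
the last expression Ω₀ denotes a characteristic function of Ω₀, Its inverse is denoted by G′, or G′(U)."* and p. 409
(verbatim) *"the sequence {Ω_n(□)} satisfies the assumptions of Corollary 3.6. The operators constructed for this
sequence, which we denote by G′_□(U), C_□(U) = (Q′(U)G′_□²(U)Q′\*(U))^{−1}, G_□(U), satisfy all the inequalities of
Theorems 3.1–3.3 correspondingly."* (§5 of `B9Thm37GlueSz`); p. 391 (L² adjoints), p. 394 (3.23)–(3.24), p. 395
(verbatim) *"Assuming some regularity of the configuration U it can be easily shown that the operator Δ′_a is
positive. This implies positivity of the operators G′, Q′G′²Q′\*, hence the existence of the operator R."* and p. 409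
(verbatim) *"hence Δ′_aG′₀ = I − Σ_{□∈𝒟} K(h_□)G′_□h_□ = I − R′."* (v6 addendum of `B9Thm37Glue`); (3.3) p. 391 and
(3.8) p. 392 (`B9Thm37Glue`); [3] (1.118) p. 36 (`B9Thm37GluePU`).  ONE locus outside the import closure is used,
in docstring prose only (no statement depends on it): [B9] p. 408 [PDF 20], READ AS AN IMAGE by this unit on the
cell's render `…/1985-cmp99-background-propagators/…-p020-x2.png` and certified verbatim in the header of the
sibling module `B9SectCLocalSeq` (not imported): *"We take Ω_j(□) = □̃⁴, Ω_{j−1}(□) is a cube with a center at the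
center of □ and dist (Ω_{j−1}(□)ᶜ, Ω_j(□)) = 2R₀M₀L^{j−1}η, and generally Ω_n(□) is a cube with a center at the
center of □ and dist(Ω_n(□)ᶜ, Ω_{n+1}(□)) = 2R₀M₀Lⁿη"* … *"For n = 0 we have dist(Ω₀(□)ᶜ, □̃⁴) < 2R₀M₀L^jη, hence
Ω₀(□) ⊂ □̃⁵."* and, same page, *"For a cube □ ∈ 𝒟 and n = 1, 2,… we define □̃ⁿ as a cube of the size (2 + 2n)ML^jη,
and with the same center as □"* — whence print's Dirichlet domain Ω₀(□) of G′_□ is a cube round the centre of □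
containing □̃⁴, hence containing □ ⊃ supp h_□ with a margin of at least one big block ≥ one lattice step.

THE POINT (value = kernel-checked bookkeeping, NOT summit progress).  After `B9Thm37GlueTorus` (entry 4) and
`B9Thm37GlueTorusE123` (entries 1, 2, 3) the four entries of (3.42) for G′ = (Δ_U + Q′\*aQ′)^{−1} stand in the
one-scale ℓ¹ torus model (geometry `torusGeom N η L M`, identity chart, b05 partition of unity `hSU`, nearest-
neighbour bonds with constant weight c₀, one-scale diagonal Q′\*aQ′ = M_q) modulo: compatibility, `hRm`, ranges,
`hsmall`, Corollary 3.6 for the G′_□ (`h342_*`), `hG` (entry 3), `hloc`, `hinv`.  The last three are of bookkeeping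
type once G′ and the G′_□ are what print says they are — inverses — and THIS FILE discharges them:
§1 folklore — an operator on the functions on a finite set with strictly positive quadratic form is a unit
(`isUnit_of_posDef`, via `LinearMap.isUnit_iff_ker_eq_bot`), so `Ring.inverse` is a two-sided inverse
(`inverse_mul_of_posDef`, `mul_inverse_of_posDef`); the characteristic-function sandwich Ω₀AΩ₀ + (1 − Ω₀) of a
strictly positive A is strictly positive (`posDef_sandwich`).  §2 the algebra of `hloc` (`hloc_of_dirichlet`):
Ω₀AΩ₀G = Ω₀, hΩ₀ = h and M_hAΩ₀ = M_hA give M_hAGM_h = M_h².  §3 Δ_U + M_q = D\*D + M_q has the quadratic form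
Σ_b((Df)(b))² + Σ_p q(p)f(p)² (`qform_covLap_add_mulOp`, from `isTransposePair_covD`), strictly positive for q > 0
(`posDef_covLap_add_mulOp`), and is symmetric (`isTransposePair_covLap_add_mulOp`).  §4 MODEL `dirInv A Ω₀ :=
Ω₀(Ω₀AΩ₀ + (1 − Ω₀))^{−1}Ω₀` — the inverse of Ω₀AΩ₀ on the functions on Ω₀, zero off Ω₀ (print's G′ = the inverse
of Δ′_a↾_{Ω₀} = Ω₀Δ′_aΩ₀): `sandwichΩ_mul_dirInv` (Ω₀AΩ₀G′ = Ω₀), `dirInv_mul_sandwichΩ` (G′Ω₀AΩ₀ = Ω₀),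
`isTransposePair_dirInv` (symmetric), `mulOp_mul_dirInv_mul_mulOp` (Ω₀G′Ω₀ = G′).  §5 the torus — LOCALITY
`mulOp_hSU_covLapQ_mulOp`: M_{h_□}(Δ_U + M_q)M_χ = M_{h_□}(Δ_U + M_q) for χ = 1 on the (M₀ + 1)-ball round the centre
of □ (supp h_□ ⊂ {dist < M₀} and D\*D couples nearest neighbours only); hence `hloc_dir` — `hloc` for ANY family
G′_□ with Ω₀(□)(Δ_U + M_q)Ω₀(□)G′_□ = Ω₀(□) and Ω₀(□) ⊇ that ball (every c, Rm, q) — and, for q > 0, `hGΩ_pos`,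
`hG_pos` (G′_□ := `dirInv`) and `hinv_pos` (G′ := `Ring.inverse`); `chiBall` records one admissible Ω₀(□).
§6 capstones, two regimes per entry n ∈ {1, 2, 3, 4}: `thm37_entryn_l1_dir` = `…_l1_diag` with `hloc` DISCHARGED
for abstract Dirichlet local inverses G′_□ on any admissible Ω₀(□) (hypotheses `hχ`, `hGΩ`; G′ abstract with
`hinv`; entry 3 keeps `hG`) — print's regime, where G′_□ IS the inverse for print's Ω₀(□) ⊃ □̃⁴ (p. 394, pp.
408–409); `thm37_entryn_l1_pos` = the same with `hloc`, `hG`, `hinv` ALL DISCHARGED for G′ := `Ring.inverse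
(Δ_U + M_q)` and G′_□ := `dirInv (Δ_U + M_q) Ω₀(□)` under a strictly positive site weight q (`hq`) and a {0,1}-valued
Ω₀(□) equal to 1 on the (M₀ + 1)-ball (`hχ01`, `hχ`) — the MODEL regime, positivity carried by q > 0 in place of
print's regularity of the configuration U (p. 395).  Each capstone is ONE application of the corresponding
`_l1_diag` / `_l1_dir` theorem with the discharged binders supplied by name.

REMAINING HYPOTHESES (NOT asserted): the torus/cube compatibility (1 ≤ M₀ ∣ N_i, 2M₀ ≤ N_i); `hRm` (Σ_k Rm(b)_{ki}
Rm(b)_{kj} = δ_{ij} — a theorem for unitary U(b) in trace-orthonormal hermitian components,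
`B9AdOrthogonal.compMat_orthogonal_herm0` / `exists_hRm_herm0` of lineage pv27, NOT imported here, so it stays a
binder); the numeric ranges (entry 3: 0 < α ≤ ½ and 0 < η); the located smallness `hsmall`; Corollary 3.6 for the
G′_□ (`h342_1`, `h342_2`, `h342_3`, `h342_4` — the substantive random-walk input, print's Theorems 3.1–3.3 for the
sequence {Ω_n(□)}, now stated for the Dirichlet local inverses); `_l1_dir`: `hχ`, `hGΩ`, `hinv` (entry 3: `hG`);
`_l1_pos`: `hq`, `hχ01`, `hχ`.

NOT ASSERTED.  Everything listed as remaining; print's positivity of Δ′_a from the regularity of U (p. 395) — the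
model takes q > 0 instead; that print's Ω₀(□) is exactly the cube of p. 408 (only "Ω₀(□) ⊇ the 1-neighbourhood of
supp h_□" is used, which Ω₀(□) ⊃ □̃⁴ gives); scales j ≥ 1 (the multiscale G′(Ω), Q′_j, {Ω_n(□)}_{n ≤ j+1}); optimal
constants; that the four entries are print's Theorem 3.7.
-/

namespace Literature.MathematicalPhysics.QuantumFieldTheory.Balaban1983to89.B9Thm37GlueTorusInv

open Finset B6RandomWalk B6RandomWalkHom B9Thm37Sum B9Thm34Ext B9Thm37Glue B9Thm37GlueT B9Thm37GlueSt B9Thm37GlueSz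
open B9Thm37GluePU B9Thm37GlueChart B9Thm37GlueTorus B9Thm37GlueTorusE123
open B5TorusCover (UT Ctr ctrU)
open B5SmoothPartition (hSU)
open B5Leibniz121 (up dist_up_le)

noncomputable section

/-! ## §1  Finite-dimensional folklore: a strictly positive operator on the functions on a finite set is a unit -/

section PosDef

variable {X : Type} [Fintype X]

/-- An operator A on the functions on a finite set whose quadratic form Σ_x f(x)(Af)(x) is strictly positive on
f ≠ 0 has trivial kernel, hence — the space being finite-dimensional — is a unit of `Module.End`. [folklore] -/
theorem isUnit_of_posDef {A : Module.End ℝ (X → ℝ)} (hA : ∀ f : X → ℝ, f ≠ 0 → 0 < ∑ x, f x * A f x) :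
    IsUnit A := by
  rw [LinearMap.isUnit_iff_ker_eq_bot, LinearMap.ker_eq_bot']
  intro f hf
  by_contra hne
  have h := hA f hne
  rw [hf] at h
  simp only [Pi.zero_apply, mul_zero, Finset.sum_const_zero, lt_self_iff_false] at h

/-- For a strictly positive A, `Ring.inverse A` is a left inverse. [folklore] -/
theorem inverse_mul_of_posDef {A : Module.End ℝ (X → ℝ)} (hA : ∀ f : X → ℝ, f ≠ 0 → 0 < ∑ x, f x * A f x) :
    Ring.inverse A * A = 1 :=
  Ring.inverse_mul_cancel A (isUnit_of_posDef hA)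

/-- For a strictly positive A, `Ring.inverse A` is a right inverse. [folklore] -/
theorem mul_inverse_of_posDef {A : Module.End ℝ (X → ℝ)} (hA : ∀ f : X → ℝ, f ≠ 0 → 0 < ∑ x, f x * A f x) :
    A * Ring.inverse A = 1 :=
  Ring.mul_inverse_cancel A (isUnit_of_posDef hA)

/-- A strictly positive quadratic form is nonnegative. [folklore] -/
theorem qform_nonneg_of_posDef {A : Module.End ℝ (X → ℝ)} (hA : ∀ f : X → ℝ, f ≠ 0 → 0 < ∑ x, f x * A f x)
    (f : X → ℝ) : 0 ≤ ∑ x, f x * A f x := by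
  by_cases hf : f = 0
  · simp only [hf, map_zero, Pi.zero_apply, mul_zero, Finset.sum_const_zero, le_refl]
  · exact (hA f hf).le

/-- **The Dirichlet sandwich of a strictly positive operator is strictly positive**: for a {0,1}-valued χ (the
characteristic function of a domain Ω₀) and χ′ = 1 − χ, the operator M_χAM_χ + M_{χ′} — Ω₀AΩ₀ on the functions on Ω₀,
completed by the identity off Ω₀ so that it acts on all of X → ℝ — has the quadratic form
Σ (χf)A(χf) + Σ χ′f² > 0 for f ≠ 0. [folklore] -/
theorem posDef_sandwich {A : Module.End ℝ (X → ℝ)} (hA : ∀ f : X → ℝ, f ≠ 0 → 0 < ∑ x, f x * A f x)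
    {χ χ' : X → ℝ} (hχ : ∀ x, χ x = 0 ∨ χ x = 1) (hχ' : ∀ x, χ x + χ' x = 1) (f : X → ℝ) (hf : f ≠ 0) :
    0 < ∑ x, f x * (mulOp χ * A * mulOp χ + mulOp χ') f x := by
  have hsplit : ∑ x, f x * (mulOp χ * A * mulOp χ + mulOp χ') f x =
      ∑ x, (mulOp χ f) x * A (mulOp χ f) x + ∑ x, χ' x * (f x * f x) := by
    rw [← Finset.sum_add_distrib]
    refine Finset.sum_congr rfl fun x _ => ?_
    simp only [LinearMap.add_apply, Pi.add_apply, Module.End.mul_apply, mulOp_apply]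
    ring
  have hχ'v : ∀ x, χ' x = 1 - χ x := fun x => by linarith [hχ' x]
  have hnn : ∀ x, 0 ≤ χ' x * (f x * f x) := fun x => by
    rcases hχ x with h | h
    · rw [hχ'v x, h, sub_zero, one_mul]; exact mul_self_nonneg _
    · rw [hχ'v x, h, sub_self, zero_mul]
  rw [hsplit]
  by_cases hχf : mulOp χ f = 0
  · obtain ⟨x₀, hx₀⟩ : ∃ x, f x ≠ 0 := Function.ne_iff.mp hf
    have hχ0 : χ x₀ = 0 := by
      rcases hχ x₀ with h | h
      · exact h
      · have h0 := congrFun hχf x₀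
        rw [mulOp_apply, h, one_mul, Pi.zero_apply] at h0
        exact absurd h0 hx₀
    rw [hχf]
    simp only [map_zero, Pi.zero_apply, mul_zero, Finset.sum_const_zero, zero_add]
    refine lt_of_lt_of_le ?_ (Finset.single_le_sum (f := fun x => χ' x * (f x * f x)) (fun x _ => hnn x)
      (Finset.mem_univ x₀))
    rw [hχ'v x₀, hχ0, sub_zero, one_mul]
    exact mul_self_pos.mpr hx₀
  · exact add_pos_of_pos_of_nonneg (hA _ hχf) (Finset.sum_nonneg fun x _ => hnn x)

end PosDef

/-! ## §2  The algebra of `hloc`: h A G h = h² for a Dirichlet inverse G on a domain Ω₀ carrying h, A local -/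

section HlocAlgebra

variable {X : Type}

/-- M_h M_χ = M_h when hχ = h (χ = 1 on the support of h). [folklore] -/
theorem mulOp_mul_mulOp_of_mul_eq {h χ : X → ℝ} (h1 : ∀ x, h x * χ x = h x) : mulOp h * mulOp χ = mulOp h := by
  refine LinearMap.ext fun μ => funext fun x => ?_
  simp only [Module.End.mul_apply, mulOp_apply]
  rw [← mul_assoc, h1]

/-- M_h M_{χ′} = 0 when hχ′ = 0 (χ′ = 0 on the support of h). [folklore] -/
theorem mulOp_mul_mulOp_of_mul_eq_zero {h χ' : X → ℝ} (h2 : ∀ x, h x * χ' x = 0) : mulOp h * mulOp χ' = 0 := by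
  refine LinearMap.ext fun μ => funext fun x => ?_
  simp only [Module.End.mul_apply, mulOp_apply, LinearMap.zero_apply, Pi.zero_apply]
  rw [← mul_assoc, h2, zero_mul]

/-- **The shape of `hloc` from a Dirichlet inverse.**  If G inverts Ω₀AΩ₀ on Ω₀ — Ω₀AΩ₀G = Ω₀ with Ω₀ = M_χ the
characteristic function of the domain (print p. 394: *"the operator Δ′_a↾_{Ω₀} = Ω₀Δ′_aΩ₀. In the last expression
Ω₀ denotes a characteristic function of Ω₀, Its inverse is denoted by G′"*, certified in §5 of `B9Thm37GlueSz`;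
for Ω₀ = Ω₀(□) this G′ is G′_□, p. 409) — h is carried by {χ = 1} (hχ = h) and A does not couple the support of h
to {χ ≠ 1} (M_hAM_χ = M_hA), then M_hAGM_h = M_h²: the located identity Δ′_aG′_□h_□ = h_□ behind (3.88) (p. 409:
*"hence Δ′_aG′₀ = I − Σ_{□∈𝒟} K(h_□)G′_□h_□ = I − R′."*), sandwiched by h_□. [cite: Balaban1985BackgroundPropagators, (3.88) p.409 + p.394 (Ω₀Δ′_aΩ₀, G′)] -/
theorem hloc_of_dirichlet {A G : Module.End ℝ (X → ℝ)} {h χ : X → ℝ} (hG : mulOp χ * A * mulOp χ * G = mulOp χ)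
    (h1 : ∀ x, h x * χ x = h x) (hAloc : mulOp h * A * mulOp χ = mulOp h * A) :
    mulOp h * A * G * mulOp h = mulOp h * mulOp h := by
  calc mulOp h * A * G * mulOp h = mulOp h * mulOp χ * A * mulOp χ * G * mulOp h := by
        rw [mulOp_mul_mulOp_of_mul_eq h1, hAloc]
    _ = mulOp h * (mulOp χ * A * mulOp χ * G) * mulOp h := by simp only [mul_assoc]
    _ = mulOp h * mulOp h := by rw [hG, mulOp_mul_mulOp_of_mul_eq h1]

end HlocAlgebra

/-! ## §3  Positivity of Δ_U + M_q in components (every Rm, c; q > 0) -/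

section CovLapPos

variable {St Cp Bd : Type} [Fintype St] [Fintype Bd] [Fintype Cp] [DecidableEq St]

/-- **The quadratic form of Δ_U + M_q in components**: Σ_p f(p)((D\*D + M_q)f)(p) = Σ_b (Df)(b)² + Σ_p q(p)f(p)² —
(3.23) ⟨λ, Δ_Uλ⟩ = ‖D λ‖² (D\* is the transpose of D, `isTransposePair_covD`) plus the diagonal part; the model of
print's definition of Δ′_a by quadratic forms ((3.23)–(3.24) p. 394, certified in the header of `B9Thm37Glue`).
[cite: Balaban1985BackgroundPropagators, (3.23)–(3.24) p.394 + (3.3) p.391 + (3.8) p.392] -/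
theorem qform_covLap_add_mulOp (src tgt : Bd → St) (c : Bd → ℝ) (Rm : Bd → Cp → Cp → ℝ) (q : St × Cp → ℝ)
    (f : St × Cp → ℝ) :
    ∑ p, f p * (covDT src tgt c Rm ∘ₗ covD src tgt c Rm + mulOp q) f p =
      ∑ b, covD src tgt c Rm f b * covD src tgt c Rm f b + ∑ p, q p * (f p * f p) := by
  rw [isTransposePair_covD src tgt c Rm f (covD src tgt c Rm f), ← Finset.sum_add_distrib]
  refine Finset.sum_congr rfl fun p _ => ?_
  simp only [LinearMap.add_apply, Pi.add_apply, LinearMap.comp_apply, mulOp_apply]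
  ring

/-- **Δ_U + M_q is strictly positive for a strictly positive site weight q** (every Rm, c): the model of p. 395
*"Assuming some regularity of the configuration U it can be easily shown that the operator Δ′_a is positive."*
(certified in the header of `B9Thm37Glue`) in the one-scale diagonal model Q′\*aQ′ = M_q, where positivity is
carried by q > 0 instead of the regularity of U. [cite: Balaban1985BackgroundPropagators, p.395 + (3.23)–(3.24) p.394] -/
theorem posDef_covLap_add_mulOp (src tgt : Bd → St) (c : Bd → ℝ) (Rm : Bd → Cp → Cp → ℝ) {q : St × Cp → ℝ}
    (hq : ∀ p, 0 < q p) (f : St × Cp → ℝ) (hf : f ≠ 0) :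
    0 < ∑ p, f p * (covDT src tgt c Rm ∘ₗ covD src tgt c Rm + mulOp q) f p := by
  rw [qform_covLap_add_mulOp]
  obtain ⟨p₀, hp₀⟩ : ∃ p, f p ≠ 0 := Function.ne_iff.mp hf
  refine add_pos_of_nonneg_of_pos (Finset.sum_nonneg fun b _ => mul_self_nonneg _) ?_
  exact lt_of_lt_of_le (mul_pos (hq p₀) (mul_self_pos.mpr hp₀))
    (Finset.single_le_sum (f := fun p => q p * (f p * f p))
      (fun p _ => mul_nonneg (hq p).le (mul_self_nonneg _)) (Finset.mem_univ p₀))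

/-- **Δ_U + M_q is symmetric** for the component pairing (every Rm, c, q). [cite: Balaban1985BackgroundPropagators, (3.23)–(3.24) p.394 + p.391] -/
theorem isTransposePair_covLap_add_mulOp (src tgt : Bd → St) (c : Bd → ℝ) (Rm : Bd → Cp → Cp → ℝ)
    (q : St × Cp → ℝ) :
    IsTransposePair (covDT src tgt c Rm ∘ₗ covD src tgt c Rm + mulOp q)
      (covDT src tgt c Rm ∘ₗ covD src tgt c Rm + mulOp q) :=
  (isTransposePair_covLap src tgt c Rm).add (isTransposePair_mulOp q)

end CovLapPos

/-! ## §4  The model of print's G′ and G′_□: `Ring.inverse` and the Dirichlet inverse `dirInv` (zero off Ω₀) -/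

section DirInv

variable {X : Type}

/-- χ + (1 − χ) = 1 pointwise. [folklore] -/
theorem compl_add (χ : X → ℝ) (x : X) : χ x + (1 - χ) x = 1 := by
  rw [Pi.sub_apply, Pi.one_apply]
  ring

/-- Ω₀² = Ω₀ for a characteristic function. [folklore] -/
theorem mulOp_idem {χ : X → ℝ} (hχ : ∀ x, χ x = 0 ∨ χ x = 1) : mulOp χ * mulOp χ = mulOp χ :=
  mulOp_mul_mulOp_of_mul_eq fun x => by rcases hχ x with h | h <;> simp only [h, mul_zero, mul_one]

/-- Ω₀(1 − Ω₀) = 0 for a characteristic function. [folklore] -/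
theorem mulOp_mul_compl {χ : X → ℝ} (hχ : ∀ x, χ x = 0 ∨ χ x = 1) : mulOp χ * mulOp (1 - χ) = 0 :=
  mulOp_mul_mulOp_of_mul_eq_zero fun x => by
    rcases hχ x with h | h <;> simp only [Pi.sub_apply, Pi.one_apply, h, sub_zero, sub_self, mul_zero, zero_mul]

/-- (1 − Ω₀)Ω₀ = 0 for a characteristic function. [folklore] -/
theorem compl_mul_mulOp {χ : X → ℝ} (hχ : ∀ x, χ x = 0 ∨ χ x = 1) : mulOp (1 - χ) * mulOp χ = 0 :=
  mulOp_mul_mulOp_of_mul_eq_zero fun x => by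
    rcases hχ x with h | h <;> simp only [Pi.sub_apply, Pi.one_apply, h, sub_zero, sub_self, mul_zero, zero_mul]

/-- Ω₀(Ω₀AΩ₀ + (1 − Ω₀)) = Ω₀AΩ₀. [folklore] -/
theorem mulOp_mul_sandwich {A : Module.End ℝ (X → ℝ)} {χ : X → ℝ} (hχ : ∀ x, χ x = 0 ∨ χ x = 1) :
    mulOp χ * (mulOp χ * A * mulOp χ + mulOp (1 - χ)) = mulOp χ * A * mulOp χ := by
  rw [mul_add, mulOp_mul_compl hχ, add_zero, ← mul_assoc, ← mul_assoc, mulOp_idem hχ]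

/-- (Ω₀AΩ₀ + (1 − Ω₀))Ω₀ = Ω₀AΩ₀. [folklore] -/
theorem sandwich_mul_mulOp {A : Module.End ℝ (X → ℝ)} {χ : X → ℝ} (hχ : ∀ x, χ x = 0 ∨ χ x = 1) :
    (mulOp χ * A * mulOp χ + mulOp (1 - χ)) * mulOp χ = mulOp χ * A * mulOp χ := by
  rw [add_mul, compl_mul_mulOp hχ, add_zero, mul_assoc (mulOp χ * A), mulOp_idem hχ]

/-- MODEL. **The Dirichlet inverse** of an operator A on the domain Ω₀ = {χ = 1} (χ a characteristic function):
G′ := Ω₀(Ω₀AΩ₀ + (1 − Ω₀))^{−1}Ω₀ — the inverse of Ω₀AΩ₀ on the functions on Ω₀ (`sandwichΩ_mul_dirInv`,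
`dirInv_mul_sandwichΩ`), extended by zero off Ω₀; the auxiliary identity block 1 − Ω₀ only makes the sandwich
invertible on all of X → ℝ (`Ring.inverse` in `Module.End`) and is cut away by the outer Ω₀'s.  Print p. 394:
*"we consider the operator Δ′_a with Dirichlet boundary conditions on ∂Ω₀, i.e. the operator Δ′_a↾_{Ω₀} =
Ω₀Δ′_aΩ₀. In the last expression Ω₀ denotes a characteristic function of Ω₀, Its inverse is denoted by G′, or
G′(U)."* (certified in §5 of `B9Thm37GlueSz`); for □ ∈ 𝒟 and Ω₀ = Ω₀(□) this is print's G′_□ (p. 409).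
[cite: Balaban1985BackgroundPropagators, p.394 (Ω₀Δ′_aΩ₀, G′) + p.409 (G′_□)] -/
def dirInv (A : Module.End ℝ (X → ℝ)) (χ : X → ℝ) : Module.End ℝ (X → ℝ) :=
  mulOp χ * Ring.inverse (mulOp χ * A * mulOp χ + mulOp (1 - χ)) * mulOp χ

/-- G′ lives on Ω₀: Ω₀G′Ω₀ = G′. [folklore] -/
theorem mulOp_mul_dirInv_mul_mulOp (A : Module.End ℝ (X → ℝ)) {χ : X → ℝ} (hχ : ∀ x, χ x = 0 ∨ χ x = 1) :
    mulOp χ * dirInv A χ * mulOp χ = dirInv A χ := by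
  rw [dirInv]
  calc mulOp χ * (mulOp χ * Ring.inverse (mulOp χ * A * mulOp χ + mulOp (1 - χ)) * mulOp χ) * mulOp χ
        = mulOp χ * mulOp χ * Ring.inverse (mulOp χ * A * mulOp χ + mulOp (1 - χ)) * (mulOp χ * mulOp χ) := by
          simp only [mul_assoc]
    _ = mulOp χ * Ring.inverse (mulOp χ * A * mulOp χ + mulOp (1 - χ)) * mulOp χ := by rw [mulOp_idem hχ]

variable [Fintype X]

/-- **G′ inverts Ω₀AΩ₀ on Ω₀ (right inverse): Ω₀AΩ₀G′ = Ω₀** when A is strictly positive and χ is a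
characteristic function — print's definition of G′ (p. 394), existence by positivity (p. 395: *"This implies
positivity of the operators G′"*, certified in the header of `B9Thm37Glue`). [cite: Balaban1985BackgroundPropagators, p.394 (G′ = the inverse of Ω₀Δ′_aΩ₀) + p.395] -/
theorem sandwichΩ_mul_dirInv {A : Module.End ℝ (X → ℝ)} (hA : ∀ f : X → ℝ, f ≠ 0 → 0 < ∑ x, f x * A f x)
    {χ : X → ℝ} (hχ : ∀ x, χ x = 0 ∨ χ x = 1) : mulOp χ * A * mulOp χ * dirInv A χ = mulOp χ := by
  have hSR := mul_inverse_of_posDef (posDef_sandwich hA hχ (compl_add χ))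
  rw [dirInv]
  calc mulOp χ * A * mulOp χ * (mulOp χ * Ring.inverse (mulOp χ * A * mulOp χ + mulOp (1 - χ)) * mulOp χ)
        = mulOp χ * A * (mulOp χ * mulOp χ) * Ring.inverse (mulOp χ * A * mulOp χ + mulOp (1 - χ)) * mulOp χ := by
          simp only [mul_assoc]
    _ = mulOp χ * (mulOp χ * A * mulOp χ + mulOp (1 - χ)) *
          Ring.inverse (mulOp χ * A * mulOp χ + mulOp (1 - χ)) * mulOp χ := by
          rw [mulOp_idem hχ, mulOp_mul_sandwich hχ]
    _ = mulOp χ := by rw [mul_assoc (mulOp χ) _ (Ring.inverse _), hSR, mul_one, mulOp_idem hχ]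

/-- **G′ inverts Ω₀AΩ₀ on Ω₀ (left inverse): G′Ω₀AΩ₀ = Ω₀.** [cite: Balaban1985BackgroundPropagators, p.394 (G′ = the inverse of Ω₀Δ′_aΩ₀) + p.395] -/
theorem dirInv_mul_sandwichΩ {A : Module.End ℝ (X → ℝ)} (hA : ∀ f : X → ℝ, f ≠ 0 → 0 < ∑ x, f x * A f x)
    {χ : X → ℝ} (hχ : ∀ x, χ x = 0 ∨ χ x = 1) : dirInv A χ * (mulOp χ * A * mulOp χ) = mulOp χ := by
  have hRS := inverse_mul_of_posDef (posDef_sandwich hA hχ (compl_add χ))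
  rw [dirInv]
  calc mulOp χ * Ring.inverse (mulOp χ * A * mulOp χ + mulOp (1 - χ)) * mulOp χ * (mulOp χ * A * mulOp χ)
        = mulOp χ * Ring.inverse (mulOp χ * A * mulOp χ + mulOp (1 - χ)) * (mulOp χ * mulOp χ * A * mulOp χ) := by
          simp only [mul_assoc]
    _ = mulOp χ * Ring.inverse (mulOp χ * A * mulOp χ + mulOp (1 - χ)) *
          ((mulOp χ * A * mulOp χ + mulOp (1 - χ)) * mulOp χ) := by rw [mulOp_idem hχ, sandwich_mul_mulOp hχ]
    _ = mulOp χ := by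
          rw [← mul_assoc, mul_assoc (mulOp χ) (Ring.inverse _) _, hRS, mul_one, mulOp_idem hχ]

/-- **G′ is symmetric** when A is: the sandwich Ω₀AΩ₀ + (1 − Ω₀) is symmetric (`isTransposePair_sandwich`), so is
its inverse (`isTransposePair_inv`), and so is Ω₀(·)Ω₀ of it — print's G′, G′_□ are L²-selfadjoint (p. 391).
[cite: Balaban1985BackgroundPropagators, p.391 (L² adjoints) + p.394 + p.409] -/
theorem isTransposePair_dirInv {A : Module.End ℝ (X → ℝ)} (hAt : IsTransposePair A A)
    (hA : ∀ f : X → ℝ, f ≠ 0 → 0 < ∑ x, f x * A f x) {χ : X → ℝ} (hχ : ∀ x, χ x = 0 ∨ χ x = 1) :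
    IsTransposePair (dirInv A χ) (dirInv A χ) := by
  have hSR := mul_inverse_of_posDef (posDef_sandwich hA hχ (compl_add χ))
  have hR := isTransposePair_inv (isTransposePair_sandwich hAt χ (1 - χ)) hSR hSR
  rw [dirInv]
  exact (((isTransposePair_mulOp χ).mul hR).mul (isTransposePair_mulOp χ)).congr_right (mul_assoc _ _ _).symm

end DirInv

/-! ## §5  The torus model: locality of Δ_U + M_q at the support of h_□, and the three binders -/

section Torus

variable {d : ℕ} {N : Fin d → ℕ} [∀ i, NeZero (N i)] {Cp : Type} [Fintype Cp]

/-- D through M_χ on a bond with both endpoints in {χ = 1}: (D(χf))(b) = (Df)(b). [folklore] -/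
theorem covD_mulOp_eq_of_one (c : UT N × Fin d → ℝ) (Rm : UT N × Fin d → Cp → Cp → ℝ) {χ : UT N → ℝ}
    (f : UT N × Cp → ℝ) {b : UT N × Fin d} (hs : χ (bsrc b) = 1) (ht : χ (btgt b) = 1) (k : Cp) :
    covD bsrc btgt c Rm (mulOp (χ ∘ Prod.fst) f) (b, k) = covD bsrc btgt c Rm f (b, k) := by
  simp only [covD_apply, mulOp_apply, Function.comp_apply, hs, ht, one_mul]

/-- Locality of D\*: (D\*g)(x, i) depends on g only through the bonds of the star of x ((3.8) p. 392). [cite: Balaban1985BackgroundPropagators, (3.8) p.392] -/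
theorem covDT_congr_star (c : UT N × Fin d → ℝ) (Rm : UT N × Fin d → Cp → Cp → ℝ)
    {g g' : (UT N × Fin d) × Cp → ℝ} {x : UT N} (h : ∀ b k, bsrc b = x ∨ btgt b = x → g (b, k) = g' (b, k))
    (i : Cp) : covDT bsrc btgt c Rm g (x, i) = covDT bsrc btgt c Rm g' (x, i) := by
  rw [covDT_apply, covDT_apply]
  refine Finset.sum_congr rfl fun b _ => ?_
  by_cases ht : btgt b = x
  · have hg : ∀ k, g (b, k) = g' (b, k) := fun k => h b k (Or.inr ht)
    simp only [hg]
  · by_cases hs : bsrc b = x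
    · have hg : ∀ k, g (b, k) = g' (b, k) := fun k => h b k (Or.inl hs)
      simp only [hg]
    · simp only [ht, hs, if_false, zero_mul, sub_self]

/-- **Locality of Δ_U + M_q at the support of h_□**: supp h_□ ⊂ {dist(·, z) < M₀} (`hSU_eq_zero_of_far`, [3]
(1.118)) and Δ_U = D\*D couples x only to x, x ± e_μ ((3.3), (3.8), (3.23)), so for any χ equal to 1 on the
(M₀ + 1)-ball round the centre z — a Dirichlet domain Ω₀(□) containing the 1-neighbourhood of □; print's Ω₀(□)
contains □̃⁴ (p. 408) — M_{h_□}(Δ_U + M_q)M_χ = M_{h_□}(Δ_U + M_q). [cite: Balaban1985BackgroundPropagators, (3.23) p.394 + (3.3) p.391 + (3.8) p.392 + p.408 (Ω₀(□)); Balaban1984PropagatorsI, (1.118) p.36] -/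
theorem mulOp_hSU_covLapQ_mulOp {M₀ : ℕ} (hM : 1 ≤ M₀) (z : Ctr N M₀) (c : UT N × Fin d → ℝ)
    (Rm : UT N × Fin d → Cp → Cp → ℝ) (q : UT N × Cp → ℝ) {χ : UT N → ℝ}
    (hχ : ∀ x, dist x (ctrU N M₀ z) < M₀ + 1 → χ x = 1) :
    mulOp (hSU N M₀ z ∘ Prod.fst) * (covDT bsrc btgt c Rm ∘ₗ covD bsrc btgt c Rm + mulOp q) *
        mulOp (χ ∘ Prod.fst) =
      mulOp (hSU N M₀ z ∘ Prod.fst) * (covDT bsrc btgt c Rm ∘ₗ covD bsrc btgt c Rm + mulOp q) := by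
  refine LinearMap.ext fun f => funext fun p => ?_
  obtain ⟨x, i⟩ := p
  simp only [Module.End.mul_apply, mulOp_apply, Function.comp_apply]
  by_cases hx : dist x (ctrU N M₀ z) < M₀
  · have hχx : χ x = 1 := hχ x (by linarith)
    congr 1
    simp only [LinearMap.add_apply, Pi.add_apply, LinearMap.comp_apply, mulOp_apply, Function.comp_apply, hχx,
      one_mul]
    congr 1
    refine covDT_congr_star c Rm (fun b k hb => covD_mulOp_eq_of_one c Rm f ?_ ?_ k) i
    · rcases hb with hb | hb
      · rw [hb]; exact hχx
      · obtain ⟨y, μ⟩ := b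
        rw [btgt_apply] at hb
        rw [bsrc_apply]
        apply hχ
        have hyx : dist y x ≤ 1 := by rw [← hb]; exact dist_up_le y μ
        calc dist y (ctrU N M₀ z) ≤ dist y x + dist x (ctrU N M₀ z) := dist_triangle _ _ _
          _ < M₀ + 1 := by linarith
    · rcases hb with hb | hb
      · obtain ⟨y, μ⟩ := b
        rw [bsrc_apply] at hb
        rw [btgt_apply]
        apply hχ
        have hyx : dist (up y μ) x ≤ 1 := by rw [← hb, dist_comm]; exact dist_up_le y μ
        calc dist (up y μ) (ctrU N M₀ z) ≤ dist (up y μ) x + dist x (ctrU N M₀ z) := dist_triangle _ _ _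
          _ < M₀ + 1 := by linarith
      · rw [hb]; exact hχx
  · simp only [hSU_eq_zero_of_far hM (not_lt.mp hx), zero_mul]

/-- h_□χ = h_□ for χ = 1 on the (M₀ + 1)-ball round the centre of □. [cite: Balaban1984PropagatorsI, (1.118) p.36 (supp h_z ⊂ □_z)] -/
theorem hSU_mul_eq_of_one {M₀ : ℕ} (hM : 1 ≤ M₀) (z : Ctr N M₀) {χ : UT N → ℝ}
    (hχ : ∀ x, dist x (ctrU N M₀ z) < M₀ + 1 → χ x = 1) (x : UT N) : hSU N M₀ z x * χ x = hSU N M₀ z x := by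
  by_cases hx : dist x (ctrU N M₀ z) < M₀
  · rw [hχ x (by linarith), mul_one]
  · rw [hSU_eq_zero_of_far hM (not_lt.mp hx), zero_mul]

/-- **`hloc` DISCHARGED for Dirichlet local inverses**: if each G′_□ inverts Ω₀(□)(Δ_U + M_q)Ω₀(□) on Ω₀(□) —
Ω₀(□)(Δ_U + M_q)Ω₀(□)G′_□ = Ω₀(□), print's definition of G′ for Ω₀ = Ω₀(□) (p. 394, p. 409) — with Ω₀(□) = {χ_□ = 1}
containing the (M₀ + 1)-ball round the centre of □, then h_□(Δ_U + M_q)G′_□h_□ = h_□²: the literal binder `hloc` of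
`thm37_entry{1,2,3,4}_l1_diag` (every c, Rm, q). [cite: Balaban1985BackgroundPropagators, (3.88) p.409 + p.394 + p.408] -/
theorem hloc_dir {M₀ : ℕ} (hM : 1 ≤ M₀) (c : UT N × Fin d → ℝ) (Rm : UT N × Fin d → Cp → Cp → ℝ)
    (q : UT N × Cp → ℝ) {χ : Ctr N M₀ → UT N → ℝ} (hχ : ∀ i x, dist x (ctrU N M₀ i) < M₀ + 1 → χ i x = 1)
    {Gsq : Ctr N M₀ → Module.End ℝ (UT N × Cp → ℝ)}
    (hGΩ : ∀ i, mulOp (χ i ∘ Prod.fst) * (covDT bsrc btgt c Rm ∘ₗ covD bsrc btgt c Rm + mulOp q) *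
      mulOp (χ i ∘ Prod.fst) * Gsq i = mulOp (χ i ∘ Prod.fst)) :
    ∀ i, mulOp (hSU N M₀ i ∘ Prod.fst) * (covDT bsrc btgt c Rm ∘ₗ covD bsrc btgt c Rm + mulOp q) *
      Gsq i * mulOp (hSU N M₀ i ∘ Prod.fst) = mulOp (hSU N M₀ i ∘ Prod.fst) * mulOp (hSU N M₀ i ∘ Prod.fst) :=
  fun i => hloc_of_dirichlet (hGΩ i) (fun p => hSU_mul_eq_of_one hM i (hχ i) p.1)
    (mulOp_hSU_covLapQ_mulOp hM i c Rm q (hχ i))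

/-- **The Dirichlet identity for G′_□ := `dirInv (Δ_U + M_q) Ω₀(□)`** (q > 0, Ω₀(□) = χ_□ a characteristic
function): Ω₀(□)(Δ_U + M_q)Ω₀(□)G′_□ = Ω₀(□) — the hypothesis `hGΩ` of `hloc_dir`. [cite: Balaban1985BackgroundPropagators, p.394 + p.395 + p.409] -/
theorem hGΩ_pos (c : UT N × Fin d → ℝ) (Rm : UT N × Fin d → Cp → Cp → ℝ) {q : UT N × Cp → ℝ}
    (hq : ∀ p, 0 < q p) {M₀ : ℕ} {χ : Ctr N M₀ → UT N → ℝ} (hχ01 : ∀ i x, χ i x = 0 ∨ χ i x = 1) :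
    ∀ i, mulOp (χ i ∘ Prod.fst) * (covDT bsrc btgt c Rm ∘ₗ covD bsrc btgt c Rm + mulOp q) *
      mulOp (χ i ∘ Prod.fst) * dirInv (covDT bsrc btgt c Rm ∘ₗ covD bsrc btgt c Rm + mulOp q) (χ i ∘ Prod.fst) =
      mulOp (χ i ∘ Prod.fst) :=
  fun i => sandwichΩ_mul_dirInv (posDef_covLap_add_mulOp bsrc btgt c Rm hq) (fun p => hχ01 i p.1)

/-- **`hG` DISCHARGED for G′_□ := `dirInv (Δ_U + M_q) Ω₀(□)`** (q > 0, Ω₀(□) = χ_□ a characteristic function):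
each G′_□ is symmetric. [cite: Balaban1985BackgroundPropagators, p.391 + p.394 + p.409] -/
theorem hG_pos (c : UT N × Fin d → ℝ) (Rm : UT N × Fin d → Cp → Cp → ℝ) {q : UT N × Cp → ℝ}
    (hq : ∀ p, 0 < q p) {M₀ : ℕ} {χ : Ctr N M₀ → UT N → ℝ} (hχ01 : ∀ i x, χ i x = 0 ∨ χ i x = 1) :
    ∀ i, IsTransposePair (dirInv (covDT bsrc btgt c Rm ∘ₗ covD bsrc btgt c Rm + mulOp q) (χ i ∘ Prod.fst))
      (dirInv (covDT bsrc btgt c Rm ∘ₗ covD bsrc btgt c Rm + mulOp q) (χ i ∘ Prod.fst)) :=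
  fun i => isTransposePair_dirInv (isTransposePair_covLap_add_mulOp bsrc btgt c Rm q)
    (posDef_covLap_add_mulOp bsrc btgt c Rm hq) (fun p => hχ01 i p.1)

/-- **`hinv` DISCHARGED for G′ := `Ring.inverse (Δ_U + M_q)`** (q > 0): G′(Δ_U + M_q) = I — print's G′ = the
inverse of Δ′_a (p. 394: *"Its inverse is denoted by G′, or G′(U)."*), here with Ω₀ = the whole torus (no
boundary), existence from positivity (p. 395: *"This implies positivity of the operators G′"*). [cite: Balaban1985BackgroundPropagators, p.394 + p.395] -/
theorem hinv_pos (c : UT N × Fin d → ℝ) (Rm : UT N × Fin d → Cp → Cp → ℝ) {q : UT N × Cp → ℝ}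
    (hq : ∀ p, 0 < q p) :
    Ring.inverse (covDT bsrc btgt c Rm ∘ₗ covD bsrc btgt c Rm + mulOp q) *
      (covDT bsrc btgt c Rm ∘ₗ covD bsrc btgt c Rm + mulOp q) = 1 :=
  inverse_mul_of_posDef (posDef_covLap_add_mulOp bsrc btgt c Rm hq)

/-- MODEL (one admissible choice of Ω₀(□), recorded to show the χ-hypotheses of §6 are met): the characteristic
function of the open (M₀ + 1)-ball round the centre of □ — the 1-neighbourhood of □.  Print's own Ω₀(□) is a larger
cube, □̃⁴ ⊂ Ω₀(□) ⊂ □̃⁵ (p. 408); the glue only uses that Ω₀(□) contains the 1-neighbourhood of supp h_□.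
[cite: Balaban1985BackgroundPropagators, p.408 (Ω₀(□)) + p.394] -/
def chiBall (N : Fin d → ℕ) [∀ i, NeZero (N i)] (M₀ : ℕ) (z : Ctr N M₀) (x : UT N) : ℝ :=
  if dist x (ctrU N M₀ z) < M₀ + 1 then 1 else 0

/-- `chiBall` is {0,1}-valued. [folklore] -/
theorem chiBall_zero_or_one (M₀ : ℕ) (z : Ctr N M₀) (x : UT N) :
    chiBall N M₀ z x = 0 ∨ chiBall N M₀ z x = 1 := by
  unfold chiBall
  split_ifs
  · exact Or.inr rfl
  · exact Or.inl rfl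

/-- `chiBall` = 1 on the (M₀ + 1)-ball. [folklore] -/
theorem chiBall_eq_one (M₀ : ℕ) (z : Ctr N M₀) (x : UT N) (hx : dist x (ctrU N M₀ z) < M₀ + 1) :
    chiBall N M₀ z x = 1 := by
  unfold chiBall
  rw [if_pos hx]

end Torus

/-! ## §6  Entries 1–4 of (3.42) for G′: `hloc` discharged for Dirichlet local inverses on any admissible Ω₀(□),
and `hloc`, `hG`, `hinv` discharged for G′ := `Ring.inverse`, G′_□ := `dirInv` (q > 0) -/

section Capstone

variable {d : ℕ} {N : Fin d → ℕ} [∀ i, NeZero (N i)] {Cp : Type}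

/-- **Entry 1 of (3.42) for G′ (|G′|, weight η²) in the one-scale ℓ¹ torus model, `hloc` DISCHARGED** for Dirichlet
local inverses: `thm37_entry1_l1_diag` with G′_□ any operator inverting Ω₀(□)(Δ_U + M_q)Ω₀(□) on Ω₀(□) —
Ω₀(□)(Δ_U + M_q)Ω₀(□)G′_□ = Ω₀(□), print's definition of G′ for the domain Ω₀ = Ω₀(□) (p. 394; G′_□ = the G′ of the
sequence {Ω_n(□)}, p. 409) — where Ω₀(□) = {χ_□ = 1} contains the (M₀ + 1)-ball round the centre of □ (print's
Ω₀(□) contains □̃⁴, p. 408).  REMAINING HYPOTHESES: compatibility, `hRm`, ranges, `hsmall`, Corollary 3.6 for the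
G′_□ (`h342_1`, `h342_2`), the Dirichlet identities `hGΩ`, `hinv`. [cite: Balaban1985BackgroundPropagators, Thm 3.7 (3.87)–(3.90) pp.408–410 + (3.42) p.397 + p.394 + p.408 + p.409] -/
theorem thm37_entry1_l1_dir [Fintype Cp] [DecidableEq Cp] {M₀ : ℕ} (hM : 1 ≤ M₀) (hdiv : ∀ i, M₀ ∣ N i)
    (h2N : ∀ i, 2 * M₀ ≤ N i) (η L M R : ℝ) (H : Prop) (hη : 0 ≤ η) (c₀ : ℝ)
    (Rm : UT N × Fin d → Cp → Cp → ℝ) (q : UT N × Cp → ℝ) (δ₀ α ρ B₀ : ℝ) {G' : Module.End ℝ (UT N × Cp → ℝ)}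
    (hRm : ∀ b i j, ∑ k, Rm b k i * Rm b k j = if i = j then 1 else 0)
    (hB₀ : 0 ≤ B₀) (hδ₀ : 0 < δ₀) (hα : 0 < α) (hα1 : α ≤ 1) (hρ : 1 ≤ ρ)
    (hsmall : (7 : ℝ) ^ d * (B₀ * Real.exp (δ₀ * ρ) *
        ((d + d * Fintype.card Cp : ℝ) * (|c₀| * (4 * d / (M₀ : ℝ)) * ((2 * ⌊ρ⌋₊ + 1 : ℝ) ^ d * η)) +
          c₀ ^ 2 * (52 * d / (M₀ : ℝ) ^ 2) * η ^ 2)) * B6.c1 d δ₀ α < 1)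
    {χ : Ctr N M₀ → UT N → ℝ} (hχ : ∀ i x, dist x (ctrU N M₀ i) < M₀ + 1 → χ i x = 1)
    {Gsq : Ctr N M₀ → Module.End ℝ (UT N × Cp → ℝ)}
    (hGΩ : ∀ i, mulOp (χ i ∘ Prod.fst) * (covDT bsrc btgt (fun _ : UT N × Fin d => c₀) Rm ∘ₗ
      covD bsrc btgt (fun _ : UT N × Fin d => c₀) Rm + mulOp q) * mulOp (χ i ∘ Prod.fst) * Gsq i =
      mulOp (χ i ∘ Prod.fst))
    (h342_1 : ∀ i, HasMajorant (g := toB6 (torusGeom N η L M) R H) (cblk (chart0 N η L M))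
      (Gsq i)
      (fun a b => B₀ * η ^ 2 * Real.exp (-(δ₀ * tdist1 N a b))))
    (h342_2 : ∀ i, HasMajorantHom (g := toB6 (torusGeom N η L M) R H) (cblk (chart0 N η L M))
      (cblkY (chart0 N η L M))
      (covD bsrc btgt (fun _ : UT N × Fin d => c₀) Rm ∘ₗ
        Gsq i)
      (fun a b => B₀ * η * Real.exp (-(δ₀ * tdist1 N a b))))
    (hinv : G' * (covDT bsrc btgt (fun _ : UT N × Fin d => c₀) Rm ∘ₗ
      covD bsrc btgt (fun _ : UT N × Fin d => c₀) Rm + mulOp q) = 1) :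
    HasMajorant (g := toB6 (torusGeom N η L M) R H) (cblk (chart0 N η L M))
      (G')
      (fun (a b : UT N) => (5 : ℝ) ^ d * B₀ * B6.c1 d δ₀ α *
        (1 - (7 : ℝ) ^ d * (B₀ * Real.exp (δ₀ * ρ) *
          ((d + d * Fintype.card Cp : ℝ) * (|c₀| * (4 * d / (M₀ : ℝ)) * ((2 * ⌊ρ⌋₊ + 1 : ℝ) ^ d * η)) +
            c₀ ^ 2 * (52 * d / (M₀ : ℝ) ^ 2) * η ^ 2)) * B6.c1 d δ₀ α)⁻¹ * η ^ 2 *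
        Real.exp (-((1 - α) * δ₀ * tdist1 N a b))) :=
  thm37_entry1_l1_diag hM hdiv h2N η L M R H hη c₀ Rm q δ₀ α ρ B₀ hRm hB₀ hδ₀ hα hα1 hρ hsmall h342_1 h342_2
    (hloc_dir hM (fun _ : UT N × Fin d => c₀) Rm q hχ hGΩ) hinv

/-- **Entry 1 of (3.42) for G′ (|G′|, weight η²) in the one-scale ℓ¹ torus model, `hloc`, `hinv` DISCHARGED**
(strictly positive site weight q): G′ := `Ring.inverse (Δ_U + M_q)` (print's G′ = the inverse of Δ′_a, p. 394;
existence by positivity, p. 395) and G′_□ := `dirInv (Δ_U + M_q) Ω₀(□)` = Ω₀(□)(Ω₀(□)(Δ_U + M_q)Ω₀(□) + (1 − Ω₀(□)))^{−1}Ω₀(□)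
(the inverse of Ω₀(□)(Δ_U + M_q)Ω₀(□) on Ω₀(□), zero off Ω₀(□)) for any characteristic function Ω₀(□) = χ_□ equal
to 1 on the (M₀ + 1)-ball round the centre of □ (e.g. `chiBall`; print's Ω₀(□) ⊃ □̃⁴, p. 408).  REMAINING
HYPOTHESES: compatibility (1 ≤ M₀ ∣ N_i, 2M₀ ≤ N_i), `hRm` (orthogonality of the R(U(b)) — a theorem for unitary
U in trace-orthonormal components, `B9AdOrthogonal.compMat_orthogonal_herm0`, not imported here), the ranges, the
located smallness `hsmall`, `hq`, and Corollary 3.6 for these G′_□ (`h342_1`, `h342_2`). [cite: Balaban1985BackgroundPropagators, Thm 3.7 (3.87)–(3.90) pp.408–410 + (3.42) p.397 + p.394 + p.395 + p.408 + p.409] -/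
theorem thm37_entry1_l1_pos [Fintype Cp] [DecidableEq Cp] {M₀ : ℕ} (hM : 1 ≤ M₀) (hdiv : ∀ i, M₀ ∣ N i)
    (h2N : ∀ i, 2 * M₀ ≤ N i) (η L M R : ℝ) (H : Prop) (hη : 0 ≤ η) (c₀ : ℝ)
    (Rm : UT N × Fin d → Cp → Cp → ℝ) (q : UT N × Cp → ℝ) (δ₀ α ρ B₀ : ℝ)
    (hRm : ∀ b i j, ∑ k, Rm b k i * Rm b k j = if i = j then 1 else 0)
    (hB₀ : 0 ≤ B₀) (hδ₀ : 0 < δ₀) (hα : 0 < α) (hα1 : α ≤ 1) (hρ : 1 ≤ ρ)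
    (hsmall : (7 : ℝ) ^ d * (B₀ * Real.exp (δ₀ * ρ) *
        ((d + d * Fintype.card Cp : ℝ) * (|c₀| * (4 * d / (M₀ : ℝ)) * ((2 * ⌊ρ⌋₊ + 1 : ℝ) ^ d * η)) +
          c₀ ^ 2 * (52 * d / (M₀ : ℝ) ^ 2) * η ^ 2)) * B6.c1 d δ₀ α < 1)
    (hq : ∀ p, 0 < q p) {χ : Ctr N M₀ → UT N → ℝ} (hχ01 : ∀ i x, χ i x = 0 ∨ χ i x = 1)
    (hχ : ∀ i x, dist x (ctrU N M₀ i) < M₀ + 1 → χ i x = 1)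
    (h342_1 : ∀ i, HasMajorant (g := toB6 (torusGeom N η L M) R H) (cblk (chart0 N η L M))
      (dirInv (covDT bsrc btgt (fun _ : UT N × Fin d => c₀) Rm ∘ₗ covD bsrc btgt (fun _ : UT N × Fin d => c₀) Rm +
        mulOp q) (χ i ∘ Prod.fst))
      (fun a b => B₀ * η ^ 2 * Real.exp (-(δ₀ * tdist1 N a b))))
    (h342_2 : ∀ i, HasMajorantHom (g := toB6 (torusGeom N η L M) R H) (cblk (chart0 N η L M))
      (cblkY (chart0 N η L M))
      (covD bsrc btgt (fun _ : UT N × Fin d => c₀) Rm ∘ₗ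
        dirInv (covDT bsrc btgt (fun _ : UT N × Fin d => c₀) Rm ∘ₗ covD bsrc btgt (fun _ : UT N × Fin d => c₀) Rm +
        mulOp q) (χ i ∘ Prod.fst))
      (fun a b => B₀ * η * Real.exp (-(δ₀ * tdist1 N a b)))) :
    HasMajorant (g := toB6 (torusGeom N η L M) R H) (cblk (chart0 N η L M))
      (Ring.inverse (covDT bsrc btgt (fun _ : UT N × Fin d => c₀) Rm ∘ₗ
          covD bsrc btgt (fun _ : UT N × Fin d => c₀) Rm + mulOp q))
      (fun (a b : UT N) => (5 : ℝ) ^ d * B₀ * B6.c1 d δ₀ α *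
        (1 - (7 : ℝ) ^ d * (B₀ * Real.exp (δ₀ * ρ) *
          ((d + d * Fintype.card Cp : ℝ) * (|c₀| * (4 * d / (M₀ : ℝ)) * ((2 * ⌊ρ⌋₊ + 1 : ℝ) ^ d * η)) +
            c₀ ^ 2 * (52 * d / (M₀ : ℝ) ^ 2) * η ^ 2)) * B6.c1 d δ₀ α)⁻¹ * η ^ 2 *
        Real.exp (-((1 - α) * δ₀ * tdist1 N a b))) :=
  thm37_entry1_l1_dir hM hdiv h2N η L M R H hη c₀ Rm q δ₀ α ρ B₀ hRm hB₀ hδ₀ hα hα1 hρ hsmall hχ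
    (hGΩ_pos (fun _ : UT N × Fin d => c₀) Rm hq hχ01) h342_1 h342_2 (hinv_pos (fun _ : UT N × Fin d => c₀) Rm hq)

/-- **Entry 2 of (3.42) for G′ (|∇_U G′|, weight η) in the one-scale ℓ¹ torus model, `hloc` DISCHARGED** for Dirichlet
local inverses: `thm37_entry2_l1_diag` with G′_□ any operator inverting Ω₀(□)(Δ_U + M_q)Ω₀(□) on Ω₀(□) —
Ω₀(□)(Δ_U + M_q)Ω₀(□)G′_□ = Ω₀(□), print's definition of G′ for the domain Ω₀ = Ω₀(□) (p. 394; G′_□ = the G′ of the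
sequence {Ω_n(□)}, p. 409) — where Ω₀(□) = {χ_□ = 1} contains the (M₀ + 1)-ball round the centre of □ (print's
Ω₀(□) contains □̃⁴, p. 408).  REMAINING HYPOTHESES: compatibility, `hRm`, ranges, `hsmall`, Corollary 3.6 for the
G′_□ (`h342_1`, `h342_2`), the Dirichlet identities `hGΩ`, `hinv`. [cite: Balaban1985BackgroundPropagators, Thm 3.7 (3.87)–(3.90) pp.408–410 + (3.42) p.397 + p.394 + p.408 + p.409] -/
theorem thm37_entry2_l1_dir [Fintype Cp] [DecidableEq Cp] {M₀ : ℕ} (hM : 1 ≤ M₀) (hdiv : ∀ i, M₀ ∣ N i)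
    (h2N : ∀ i, 2 * M₀ ≤ N i) (η L M R : ℝ) (H : Prop) (hη : 0 ≤ η) (c₀ : ℝ)
    (Rm : UT N × Fin d → Cp → Cp → ℝ) (q : UT N × Cp → ℝ) (δ₀ α ρ B₀ : ℝ) {G' : Module.End ℝ (UT N × Cp → ℝ)}
    (hRm : ∀ b i j, ∑ k, Rm b k i * Rm b k j = if i = j then 1 else 0)
    (hB₀ : 0 ≤ B₀) (hδ₀ : 0 < δ₀) (hα : 0 < α) (hα1 : α ≤ 1) (hρ : 1 ≤ ρ)
    (hsmall : (7 : ℝ) ^ d * (B₀ * Real.exp (δ₀ * ρ) *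
        ((d + d * Fintype.card Cp : ℝ) * (|c₀| * (4 * d / (M₀ : ℝ)) * ((2 * ⌊ρ⌋₊ + 1 : ℝ) ^ d * η)) +
          c₀ ^ 2 * (52 * d / (M₀ : ℝ) ^ 2) * η ^ 2)) * B6.c1 d δ₀ α < 1)
    {χ : Ctr N M₀ → UT N → ℝ} (hχ : ∀ i x, dist x (ctrU N M₀ i) < M₀ + 1 → χ i x = 1)
    {Gsq : Ctr N M₀ → Module.End ℝ (UT N × Cp → ℝ)}
    (hGΩ : ∀ i, mulOp (χ i ∘ Prod.fst) * (covDT bsrc btgt (fun _ : UT N × Fin d => c₀) Rm ∘ₗ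
      covD bsrc btgt (fun _ : UT N × Fin d => c₀) Rm + mulOp q) * mulOp (χ i ∘ Prod.fst) * Gsq i =
      mulOp (χ i ∘ Prod.fst))
    (h342_1 : ∀ i, HasMajorant (g := toB6 (torusGeom N η L M) R H) (cblk (chart0 N η L M))
      (Gsq i)
      (fun a b => B₀ * η ^ 2 * Real.exp (-(δ₀ * tdist1 N a b))))
    (h342_2 : ∀ i, HasMajorantHom (g := toB6 (torusGeom N η L M) R H) (cblk (chart0 N η L M))
      (cblkY (chart0 N η L M))
      (covD bsrc btgt (fun _ : UT N × Fin d => c₀) Rm ∘ₗ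
        Gsq i)
      (fun a b => B₀ * η * Real.exp (-(δ₀ * tdist1 N a b))))
    (hinv : G' * (covDT bsrc btgt (fun _ : UT N × Fin d => c₀) Rm ∘ₗ
      covD bsrc btgt (fun _ : UT N × Fin d => c₀) Rm + mulOp q) = 1) :
    HasMajorantHom (g := toB6 (torusGeom N η L M) R H) (cblk (chart0 N η L M)) (cblkY (chart0 N η L M))
      (covD bsrc btgt (fun _ : UT N × Fin d => c₀) Rm ∘ₗ
        G')
      (fun (a b : UT N) => B₀ * ((7 : ℝ) ^ d + (7 : ℝ) ^ d * Real.exp (δ₀ * ρ) *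
          (|c₀| * (4 * d / (M₀ : ℝ)) * ((2 * ⌊ρ⌋₊ + 1 : ℝ) ^ d * η))) * B6.c1 d δ₀ α *
        (1 - (7 : ℝ) ^ d * (B₀ * Real.exp (δ₀ * ρ) *
          ((d + d * Fintype.card Cp : ℝ) * (|c₀| * (4 * d / (M₀ : ℝ)) * ((2 * ⌊ρ⌋₊ + 1 : ℝ) ^ d * η)) +
            c₀ ^ 2 * (52 * d / (M₀ : ℝ) ^ 2) * η ^ 2)) * B6.c1 d δ₀ α)⁻¹ * η *
        Real.exp (-((1 - α) * δ₀ * tdist1 N a b))) :=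
  thm37_entry2_l1_diag hM hdiv h2N η L M R H hη c₀ Rm q δ₀ α ρ B₀ hRm hB₀ hδ₀ hα hα1 hρ hsmall h342_1 h342_2
    (hloc_dir hM (fun _ : UT N × Fin d => c₀) Rm q hχ hGΩ) hinv

/-- **Entry 2 of (3.42) for G′ (|∇_U G′|, weight η) in the one-scale ℓ¹ torus model, `hloc`, `hinv` DISCHARGED**
(strictly positive site weight q): G′ := `Ring.inverse (Δ_U + M_q)` (print's G′ = the inverse of Δ′_a, p. 394;
existence by positivity, p. 395) and G′_□ := `dirInv (Δ_U + M_q) Ω₀(□)` = Ω₀(□)(Ω₀(□)(Δ_U + M_q)Ω₀(□) + (1 − Ω₀(□)))^{−1}Ω₀(□)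
(the inverse of Ω₀(□)(Δ_U + M_q)Ω₀(□) on Ω₀(□), zero off Ω₀(□)) for any characteristic function Ω₀(□) = χ_□ equal
to 1 on the (M₀ + 1)-ball round the centre of □ (e.g. `chiBall`; print's Ω₀(□) ⊃ □̃⁴, p. 408).  REMAINING
HYPOTHESES: compatibility (1 ≤ M₀ ∣ N_i, 2M₀ ≤ N_i), `hRm` (orthogonality of the R(U(b)) — a theorem for unitary
U in trace-orthonormal components, `B9AdOrthogonal.compMat_orthogonal_herm0`, not imported here), the ranges, the
located smallness `hsmall`, `hq`, and Corollary 3.6 for these G′_□ (`h342_1`, `h342_2`). [cite: Balaban1985BackgroundPropagators, Thm 3.7 (3.87)–(3.90) pp.408–410 + (3.42) p.397 + p.394 + p.395 + p.408 + p.409] -/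
theorem thm37_entry2_l1_pos [Fintype Cp] [DecidableEq Cp] {M₀ : ℕ} (hM : 1 ≤ M₀) (hdiv : ∀ i, M₀ ∣ N i)
    (h2N : ∀ i, 2 * M₀ ≤ N i) (η L M R : ℝ) (H : Prop) (hη : 0 ≤ η) (c₀ : ℝ)
    (Rm : UT N × Fin d → Cp → Cp → ℝ) (q : UT N × Cp → ℝ) (δ₀ α ρ B₀ : ℝ)
    (hRm : ∀ b i j, ∑ k, Rm b k i * Rm b k j = if i = j then 1 else 0)
    (hB₀ : 0 ≤ B₀) (hδ₀ : 0 < δ₀) (hα : 0 < α) (hα1 : α ≤ 1) (hρ : 1 ≤ ρ)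
    (hsmall : (7 : ℝ) ^ d * (B₀ * Real.exp (δ₀ * ρ) *
        ((d + d * Fintype.card Cp : ℝ) * (|c₀| * (4 * d / (M₀ : ℝ)) * ((2 * ⌊ρ⌋₊ + 1 : ℝ) ^ d * η)) +
          c₀ ^ 2 * (52 * d / (M₀ : ℝ) ^ 2) * η ^ 2)) * B6.c1 d δ₀ α < 1)
    (hq : ∀ p, 0 < q p) {χ : Ctr N M₀ → UT N → ℝ} (hχ01 : ∀ i x, χ i x = 0 ∨ χ i x = 1)
    (hχ : ∀ i x, dist x (ctrU N M₀ i) < M₀ + 1 → χ i x = 1)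
    (h342_1 : ∀ i, HasMajorant (g := toB6 (torusGeom N η L M) R H) (cblk (chart0 N η L M))
      (dirInv (covDT bsrc btgt (fun _ : UT N × Fin d => c₀) Rm ∘ₗ covD bsrc btgt (fun _ : UT N × Fin d => c₀) Rm +
        mulOp q) (χ i ∘ Prod.fst))
      (fun a b => B₀ * η ^ 2 * Real.exp (-(δ₀ * tdist1 N a b))))
    (h342_2 : ∀ i, HasMajorantHom (g := toB6 (torusGeom N η L M) R H) (cblk (chart0 N η L M))
      (cblkY (chart0 N η L M))
      (covD bsrc btgt (fun _ : UT N × Fin d => c₀) Rm ∘ₗ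
        dirInv (covDT bsrc btgt (fun _ : UT N × Fin d => c₀) Rm ∘ₗ covD bsrc btgt (fun _ : UT N × Fin d => c₀) Rm +
        mulOp q) (χ i ∘ Prod.fst))
      (fun a b => B₀ * η * Real.exp (-(δ₀ * tdist1 N a b)))) :
    HasMajorantHom (g := toB6 (torusGeom N η L M) R H) (cblk (chart0 N η L M)) (cblkY (chart0 N η L M))
      (covD bsrc btgt (fun _ : UT N × Fin d => c₀) Rm ∘ₗ
        Ring.inverse (covDT bsrc btgt (fun _ : UT N × Fin d => c₀) Rm ∘ₗ
          covD bsrc btgt (fun _ : UT N × Fin d => c₀) Rm + mulOp q))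
      (fun (a b : UT N) => B₀ * ((7 : ℝ) ^ d + (7 : ℝ) ^ d * Real.exp (δ₀ * ρ) *
          (|c₀| * (4 * d / (M₀ : ℝ)) * ((2 * ⌊ρ⌋₊ + 1 : ℝ) ^ d * η))) * B6.c1 d δ₀ α *
        (1 - (7 : ℝ) ^ d * (B₀ * Real.exp (δ₀ * ρ) *
          ((d + d * Fintype.card Cp : ℝ) * (|c₀| * (4 * d / (M₀ : ℝ)) * ((2 * ⌊ρ⌋₊ + 1 : ℝ) ^ d * η)) +
            c₀ ^ 2 * (52 * d / (M₀ : ℝ) ^ 2) * η ^ 2)) * B6.c1 d δ₀ α)⁻¹ * η *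
        Real.exp (-((1 - α) * δ₀ * tdist1 N a b))) :=
  thm37_entry2_l1_dir hM hdiv h2N η L M R H hη c₀ Rm q δ₀ α ρ B₀ hRm hB₀ hδ₀ hα hα1 hρ hsmall hχ
    (hGΩ_pos (fun _ : UT N × Fin d => c₀) Rm hq hχ01) h342_1 h342_2 (hinv_pos (fun _ : UT N × Fin d => c₀) Rm hq)

/-- **Entry 4 of (3.42) for G′ (|Δ_U G′|, weight 1) in the one-scale ℓ¹ torus model, `hloc` DISCHARGED** for Dirichlet
local inverses: `thm37_entry4_l1_diag` with G′_□ any operator inverting Ω₀(□)(Δ_U + M_q)Ω₀(□) on Ω₀(□) —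
Ω₀(□)(Δ_U + M_q)Ω₀(□)G′_□ = Ω₀(□), print's definition of G′ for the domain Ω₀ = Ω₀(□) (p. 394; G′_□ = the G′ of the
sequence {Ω_n(□)}, p. 409) — where Ω₀(□) = {χ_□ = 1} contains the (M₀ + 1)-ball round the centre of □ (print's
Ω₀(□) contains □̃⁴, p. 408).  REMAINING HYPOTHESES: compatibility, `hRm`, ranges, `hsmall`, Corollary 3.6 for the
G′_□ (`h342_1`, `h342_2`, `h342_4`), the Dirichlet identities `hGΩ`, `hinv`. [cite: Balaban1985BackgroundPropagators, Thm 3.7 (3.87)–(3.90) pp.408–410 + (3.42) p.397 + p.394 + p.408 + p.409] -/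
theorem thm37_entry4_l1_dir [Fintype Cp] [DecidableEq Cp] {M₀ : ℕ} (hM : 1 ≤ M₀) (hdiv : ∀ i, M₀ ∣ N i)
    (h2N : ∀ i, 2 * M₀ ≤ N i) (η L M R : ℝ) (H : Prop) (hη : 0 ≤ η) (c₀ : ℝ)
    (Rm : UT N × Fin d → Cp → Cp → ℝ) (q : UT N × Cp → ℝ) (δ₀ α ρ B₀ : ℝ) {G' : Module.End ℝ (UT N × Cp → ℝ)}
    (hRm : ∀ b i j, ∑ k, Rm b k i * Rm b k j = if i = j then 1 else 0)
    (hB₀ : 0 ≤ B₀) (hδ₀ : 0 < δ₀) (hα : 0 < α) (hα1 : α ≤ 1) (hρ : 1 ≤ ρ)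
    (hsmall : (7 : ℝ) ^ d * (B₀ * Real.exp (δ₀ * ρ) *
        ((d + d * Fintype.card Cp : ℝ) * (|c₀| * (4 * d / (M₀ : ℝ)) * ((2 * ⌊ρ⌋₊ + 1 : ℝ) ^ d * η)) +
          c₀ ^ 2 * (52 * d / (M₀ : ℝ) ^ 2) * η ^ 2)) * B6.c1 d δ₀ α < 1)
    {χ : Ctr N M₀ → UT N → ℝ} (hχ : ∀ i x, dist x (ctrU N M₀ i) < M₀ + 1 → χ i x = 1)
    {Gsq : Ctr N M₀ → Module.End ℝ (UT N × Cp → ℝ)}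
    (hGΩ : ∀ i, mulOp (χ i ∘ Prod.fst) * (covDT bsrc btgt (fun _ : UT N × Fin d => c₀) Rm ∘ₗ
      covD bsrc btgt (fun _ : UT N × Fin d => c₀) Rm + mulOp q) * mulOp (χ i ∘ Prod.fst) * Gsq i =
      mulOp (χ i ∘ Prod.fst))
    (h342_1 : ∀ i, HasMajorant (g := toB6 (torusGeom N η L M) R H) (cblk (chart0 N η L M))
      (Gsq i)
      (fun a b => B₀ * η ^ 2 * Real.exp (-(δ₀ * tdist1 N a b))))
    (h342_2 : ∀ i, HasMajorantHom (g := toB6 (torusGeom N η L M) R H) (cblk (chart0 N η L M))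
      (cblkY (chart0 N η L M))
      (covD bsrc btgt (fun _ : UT N × Fin d => c₀) Rm ∘ₗ
        Gsq i)
      (fun a b => B₀ * η * Real.exp (-(δ₀ * tdist1 N a b))))
    (h342_4 : ∀ i, HasMajorantHom (g := toB6 (torusGeom N η L M) R H) (cblk (chart0 N η L M))
      (cblk (chart0 N η L M))
      ((covDT bsrc btgt (fun _ : UT N × Fin d => c₀) Rm ∘ₗ covD bsrc btgt (fun _ : UT N × Fin d => c₀) Rm) ∘ₗ
        Gsq i)
      (fun a b => B₀ * Real.exp (-(δ₀ * tdist1 N a b))))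
    (hinv : G' * (covDT bsrc btgt (fun _ : UT N × Fin d => c₀) Rm ∘ₗ
      covD bsrc btgt (fun _ : UT N × Fin d => c₀) Rm + mulOp q) = 1) :
    HasMajorantHom (g := toB6 (torusGeom N η L M) R H) (cblk (chart0 N η L M)) (cblk (chart0 N η L M))
      ((covDT bsrc btgt (fun _ : UT N × Fin d => c₀) Rm ∘ₗ covD bsrc btgt (fun _ : UT N × Fin d => c₀) Rm) ∘ₗ
        G')
      (fun (a b : UT N) => B₀ * ((5 : ℝ) ^ d + (7 : ℝ) ^ d * Real.exp (δ₀ * ρ) *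
          ((d + d * Fintype.card Cp : ℝ) * (|c₀| * (4 * d / (M₀ : ℝ)) * ((2 * ⌊ρ⌋₊ + 1 : ℝ) ^ d * η)) +
            c₀ ^ 2 * (52 * d / (M₀ : ℝ) ^ 2) * η ^ 2)) *
        B6.c1 d δ₀ α *
        (1 - (7 : ℝ) ^ d * (B₀ * Real.exp (δ₀ * ρ) *
          ((d + d * Fintype.card Cp : ℝ) * (|c₀| * (4 * d / (M₀ : ℝ)) * ((2 * ⌊ρ⌋₊ + 1 : ℝ) ^ d * η)) +
            c₀ ^ 2 * (52 * d / (M₀ : ℝ) ^ 2) * η ^ 2)) * B6.c1 d δ₀ α)⁻¹ *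
        Real.exp (-((1 - α) * δ₀ * tdist1 N a b))) :=
  thm37_entry4_l1_diag hM hdiv h2N η L M R H hη c₀ Rm q δ₀ α ρ B₀ hRm hB₀ hδ₀ hα hα1 hρ hsmall h342_1 h342_2 h342_4
    (hloc_dir hM (fun _ : UT N × Fin d => c₀) Rm q hχ hGΩ) hinv

/-- **Entry 4 of (3.42) for G′ (|Δ_U G′|, weight 1) in the one-scale ℓ¹ torus model, `hloc`, `hinv` DISCHARGED**
(strictly positive site weight q): G′ := `Ring.inverse (Δ_U + M_q)` (print's G′ = the inverse of Δ′_a, p. 394;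
existence by positivity, p. 395) and G′_□ := `dirInv (Δ_U + M_q) Ω₀(□)` = Ω₀(□)(Ω₀(□)(Δ_U + M_q)Ω₀(□) + (1 − Ω₀(□)))^{−1}Ω₀(□)
(the inverse of Ω₀(□)(Δ_U + M_q)Ω₀(□) on Ω₀(□), zero off Ω₀(□)) for any characteristic function Ω₀(□) = χ_□ equal
to 1 on the (M₀ + 1)-ball round the centre of □ (e.g. `chiBall`; print's Ω₀(□) ⊃ □̃⁴, p. 408).  REMAINING
HYPOTHESES: compatibility (1 ≤ M₀ ∣ N_i, 2M₀ ≤ N_i), `hRm` (orthogonality of the R(U(b)) — a theorem for unitary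
U in trace-orthonormal components, `B9AdOrthogonal.compMat_orthogonal_herm0`, not imported here), the ranges, the
located smallness `hsmall`, `hq`, and Corollary 3.6 for these G′_□ (`h342_1`, `h342_2`, `h342_4`). [cite: Balaban1985BackgroundPropagators, Thm 3.7 (3.87)–(3.90) pp.408–410 + (3.42) p.397 + p.394 + p.395 + p.408 + p.409] -/
theorem thm37_entry4_l1_pos [Fintype Cp] [DecidableEq Cp] {M₀ : ℕ} (hM : 1 ≤ M₀) (hdiv : ∀ i, M₀ ∣ N i)
    (h2N : ∀ i, 2 * M₀ ≤ N i) (η L M R : ℝ) (H : Prop) (hη : 0 ≤ η) (c₀ : ℝ)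
    (Rm : UT N × Fin d → Cp → Cp → ℝ) (q : UT N × Cp → ℝ) (δ₀ α ρ B₀ : ℝ)
    (hRm : ∀ b i j, ∑ k, Rm b k i * Rm b k j = if i = j then 1 else 0)
    (hB₀ : 0 ≤ B₀) (hδ₀ : 0 < δ₀) (hα : 0 < α) (hα1 : α ≤ 1) (hρ : 1 ≤ ρ)
    (hsmall : (7 : ℝ) ^ d * (B₀ * Real.exp (δ₀ * ρ) *
        ((d + d * Fintype.card Cp : ℝ) * (|c₀| * (4 * d / (M₀ : ℝ)) * ((2 * ⌊ρ⌋₊ + 1 : ℝ) ^ d * η)) +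
          c₀ ^ 2 * (52 * d / (M₀ : ℝ) ^ 2) * η ^ 2)) * B6.c1 d δ₀ α < 1)
    (hq : ∀ p, 0 < q p) {χ : Ctr N M₀ → UT N → ℝ} (hχ01 : ∀ i x, χ i x = 0 ∨ χ i x = 1)
    (hχ : ∀ i x, dist x (ctrU N M₀ i) < M₀ + 1 → χ i x = 1)
    (h342_1 : ∀ i, HasMajorant (g := toB6 (torusGeom N η L M) R H) (cblk (chart0 N η L M))
      (dirInv (covDT bsrc btgt (fun _ : UT N × Fin d => c₀) Rm ∘ₗ covD bsrc btgt (fun _ : UT N × Fin d => c₀) Rm +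
        mulOp q) (χ i ∘ Prod.fst))
      (fun a b => B₀ * η ^ 2 * Real.exp (-(δ₀ * tdist1 N a b))))
    (h342_2 : ∀ i, HasMajorantHom (g := toB6 (torusGeom N η L M) R H) (cblk (chart0 N η L M))
      (cblkY (chart0 N η L M))
      (covD bsrc btgt (fun _ : UT N × Fin d => c₀) Rm ∘ₗ
        dirInv (covDT bsrc btgt (fun _ : UT N × Fin d => c₀) Rm ∘ₗ covD bsrc btgt (fun _ : UT N × Fin d => c₀) Rm +
        mulOp q) (χ i ∘ Prod.fst))
      (fun a b => B₀ * η * Real.exp (-(δ₀ * tdist1 N a b))))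
    (h342_4 : ∀ i, HasMajorantHom (g := toB6 (torusGeom N η L M) R H) (cblk (chart0 N η L M))
      (cblk (chart0 N η L M))
      ((covDT bsrc btgt (fun _ : UT N × Fin d => c₀) Rm ∘ₗ covD bsrc btgt (fun _ : UT N × Fin d => c₀) Rm) ∘ₗ
        dirInv (covDT bsrc btgt (fun _ : UT N × Fin d => c₀) Rm ∘ₗ covD bsrc btgt (fun _ : UT N × Fin d => c₀) Rm +
        mulOp q) (χ i ∘ Prod.fst))
      (fun a b => B₀ * Real.exp (-(δ₀ * tdist1 N a b)))) :
    HasMajorantHom (g := toB6 (torusGeom N η L M) R H) (cblk (chart0 N η L M)) (cblk (chart0 N η L M))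
      ((covDT bsrc btgt (fun _ : UT N × Fin d => c₀) Rm ∘ₗ covD bsrc btgt (fun _ : UT N × Fin d => c₀) Rm) ∘ₗ
        Ring.inverse (covDT bsrc btgt (fun _ : UT N × Fin d => c₀) Rm ∘ₗ
          covD bsrc btgt (fun _ : UT N × Fin d => c₀) Rm + mulOp q))
      (fun (a b : UT N) => B₀ * ((5 : ℝ) ^ d + (7 : ℝ) ^ d * Real.exp (δ₀ * ρ) *
          ((d + d * Fintype.card Cp : ℝ) * (|c₀| * (4 * d / (M₀ : ℝ)) * ((2 * ⌊ρ⌋₊ + 1 : ℝ) ^ d * η)) +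
            c₀ ^ 2 * (52 * d / (M₀ : ℝ) ^ 2) * η ^ 2)) *
        B6.c1 d δ₀ α *
        (1 - (7 : ℝ) ^ d * (B₀ * Real.exp (δ₀ * ρ) *
          ((d + d * Fintype.card Cp : ℝ) * (|c₀| * (4 * d / (M₀ : ℝ)) * ((2 * ⌊ρ⌋₊ + 1 : ℝ) ^ d * η)) +
            c₀ ^ 2 * (52 * d / (M₀ : ℝ) ^ 2) * η ^ 2)) * B6.c1 d δ₀ α)⁻¹ *
        Real.exp (-((1 - α) * δ₀ * tdist1 N a b))) :=
  thm37_entry4_l1_dir hM hdiv h2N η L M R H hη c₀ Rm q δ₀ α ρ B₀ hRm hB₀ hδ₀ hα hα1 hρ hsmall hχ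
    (hGΩ_pos (fun _ : UT N × Fin d => c₀) Rm hq hχ01) h342_1 h342_2 h342_4 (hinv_pos (fun _ : UT N × Fin d => c₀) Rm hq)

/-- **Entry 3 of (3.42) for G′ (|G′∇*_U|, weight η) in the one-scale ℓ¹ torus model, `hloc` DISCHARGED** for Dirichlet
local inverses: `thm37_entry3_l1_diag` with G′_□ any operator inverting Ω₀(□)(Δ_U + M_q)Ω₀(□) on Ω₀(□) —
Ω₀(□)(Δ_U + M_q)Ω₀(□)G′_□ = Ω₀(□), print's definition of G′ for the domain Ω₀ = Ω₀(□) (p. 394; G′_□ = the G′ of the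
sequence {Ω_n(□)}, p. 409) — where Ω₀(□) = {χ_□ = 1} contains the (M₀ + 1)-ball round the centre of □ (print's
Ω₀(□) contains □̃⁴, p. 408).  REMAINING HYPOTHESES: compatibility, `hRm`, ranges, `hsmall`, Corollary 3.6 for the
G′_□ (`h342_1`, `h342_3`), the symmetry `hG` of the G′_□, the Dirichlet identities `hGΩ`, `hinv`. [cite: Balaban1985BackgroundPropagators, Thm 3.7 (3.87)–(3.90) pp.408–410 + (3.42) p.397 + p.394 + p.408 + p.409] -/
theorem thm37_entry3_l1_dir [Fintype Cp] [DecidableEq Cp] {M₀ : ℕ} (hM : 1 ≤ M₀) (hdiv : ∀ i, M₀ ∣ N i)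
    (h2N : ∀ i, 2 * M₀ ≤ N i) (η L M R : ℝ) (H : Prop) (hη : 0 < η) (c₀ : ℝ)
    (Rm : UT N × Fin d → Cp → Cp → ℝ) (q : UT N × Cp → ℝ) (δ₀ α ρ B₀ : ℝ) {G' : Module.End ℝ (UT N × Cp → ℝ)}
    (hRm : ∀ b i j, ∑ k, Rm b k i * Rm b k j = if i = j then 1 else 0)
    (hB₀ : 0 ≤ B₀) (hδ₀ : 0 < δ₀) (hα : 0 < α) (hα2 : 2 * α ≤ 1) (hρ : 1 ≤ ρ)
    (hsmall : (7 : ℝ) ^ d * (B₀ * Real.exp (δ₀ * ρ) *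
        ((1 + Fintype.card Cp : ℝ) * (|c₀| * (4 * d / (M₀ : ℝ)) * ((2 * ⌊ρ⌋₊ + 1 : ℝ) ^ d * η)) +
          c₀ ^ 2 * (52 * d / (M₀ : ℝ) ^ 2) * η ^ 2)) * B6.c1 d δ₀ α < 1)
    {χ : Ctr N M₀ → UT N → ℝ} (hχ : ∀ i x, dist x (ctrU N M₀ i) < M₀ + 1 → χ i x = 1)
    {Gsq : Ctr N M₀ → Module.End ℝ (UT N × Cp → ℝ)}
    (hGΩ : ∀ i, mulOp (χ i ∘ Prod.fst) * (covDT bsrc btgt (fun _ : UT N × Fin d => c₀) Rm ∘ₗ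
      covD bsrc btgt (fun _ : UT N × Fin d => c₀) Rm + mulOp q) * mulOp (χ i ∘ Prod.fst) * Gsq i =
      mulOp (χ i ∘ Prod.fst))
    (h342_1 : ∀ i, HasMajorant (g := toB6 (torusGeom N η L M) R H) (cblk (chart0 N η L M))
      (Gsq i)
      (fun a b => B₀ * η ^ 2 * Real.exp (-(δ₀ * tdist1 N a b))))
    (h342_3 : ∀ i, HasMajorantHom (g := toB6 (torusGeom N η L M) R H) (cblkY (chart0 N η L M))
      (cblk (chart0 N η L M))
      (Gsq i ∘ₗ
        covDT bsrc btgt (fun _ : UT N × Fin d => c₀) Rm)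
      (fun a b => B₀ * η * Real.exp (-(δ₀ * tdist1 N a b))))
    (hG : ∀ i, IsTransposePair (Gsq i) (Gsq i))
    (hinv : G' * (covDT bsrc btgt (fun _ : UT N × Fin d => c₀) Rm ∘ₗ
      covD bsrc btgt (fun _ : UT N × Fin d => c₀) Rm + mulOp q) = 1) :
    HasMajorantHom (g := toB6 (torusGeom N η L M) R H) (cblkY (chart0 N η L M)) (cblk (chart0 N η L M))
      (G' ∘ₗ
        covDT bsrc btgt (fun _ : UT N × Fin d => c₀) Rm)
      (fun (a b : UT N) => B₀ * ((5 : ℝ) ^ d + (7 : ℝ) ^ d * Real.exp (δ₀ * ρ) *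
          (d * (|c₀| * (4 * d / (M₀ : ℝ)) * ((2 * ⌊ρ⌋₊ + 1 : ℝ) ^ d * η)))) * B6.c1 d δ₀ α *
        (1 - (7 : ℝ) ^ d * (B₀ * Real.exp (δ₀ * ρ) *
          ((1 + Fintype.card Cp : ℝ) * (|c₀| * (4 * d / (M₀ : ℝ)) * ((2 * ⌊ρ⌋₊ + 1 : ℝ) ^ d * η)) +
            c₀ ^ 2 * (52 * d / (M₀ : ℝ) ^ 2) * η ^ 2)) * B6.c1 d δ₀ α)⁻¹ * η *
        Real.exp (-((1 - 2 * α) * δ₀ * tdist1 N a b))) :=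
  thm37_entry3_l1_diag hM hdiv h2N η L M R H hη c₀ Rm q δ₀ α ρ B₀ hRm hB₀ hδ₀ hα hα2 hρ hsmall h342_1 h342_3 hG
    (hloc_dir hM (fun _ : UT N × Fin d => c₀) Rm q hχ hGΩ) hinv

/-- **Entry 3 of (3.42) for G′ (|G′∇*_U|, weight η) in the one-scale ℓ¹ torus model, `hloc`, `hG`, `hinv` DISCHARGED**
(strictly positive site weight q): G′ := `Ring.inverse (Δ_U + M_q)` (print's G′ = the inverse of Δ′_a, p. 394;
existence by positivity, p. 395) and G′_□ := `dirInv (Δ_U + M_q) Ω₀(□)` = Ω₀(□)(Ω₀(□)(Δ_U + M_q)Ω₀(□) + (1 − Ω₀(□)))^{−1}Ω₀(□)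
(the inverse of Ω₀(□)(Δ_U + M_q)Ω₀(□) on Ω₀(□), zero off Ω₀(□)) for any characteristic function Ω₀(□) = χ_□ equal
to 1 on the (M₀ + 1)-ball round the centre of □ (e.g. `chiBall`; print's Ω₀(□) ⊃ □̃⁴, p. 408).  REMAINING
HYPOTHESES: compatibility (1 ≤ M₀ ∣ N_i, 2M₀ ≤ N_i), `hRm` (orthogonality of the R(U(b)) — a theorem for unitary
U in trace-orthonormal components, `B9AdOrthogonal.compMat_orthogonal_herm0`, not imported here), the ranges, the
located smallness `hsmall`, `hq`, and Corollary 3.6 for these G′_□ (`h342_1`, `h342_3`). [cite: Balaban1985BackgroundPropagators, Thm 3.7 (3.87)–(3.90) pp.408–410 + (3.42) p.397 + p.394 + p.395 + p.408 + p.409] -/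
theorem thm37_entry3_l1_pos [Fintype Cp] [DecidableEq Cp] {M₀ : ℕ} (hM : 1 ≤ M₀) (hdiv : ∀ i, M₀ ∣ N i)
    (h2N : ∀ i, 2 * M₀ ≤ N i) (η L M R : ℝ) (H : Prop) (hη : 0 < η) (c₀ : ℝ)
    (Rm : UT N × Fin d → Cp → Cp → ℝ) (q : UT N × Cp → ℝ) (δ₀ α ρ B₀ : ℝ)
    (hRm : ∀ b i j, ∑ k, Rm b k i * Rm b k j = if i = j then 1 else 0)
    (hB₀ : 0 ≤ B₀) (hδ₀ : 0 < δ₀) (hα : 0 < α) (hα2 : 2 * α ≤ 1) (hρ : 1 ≤ ρ)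
    (hsmall : (7 : ℝ) ^ d * (B₀ * Real.exp (δ₀ * ρ) *
        ((1 + Fintype.card Cp : ℝ) * (|c₀| * (4 * d / (M₀ : ℝ)) * ((2 * ⌊ρ⌋₊ + 1 : ℝ) ^ d * η)) +
          c₀ ^ 2 * (52 * d / (M₀ : ℝ) ^ 2) * η ^ 2)) * B6.c1 d δ₀ α < 1)
    (hq : ∀ p, 0 < q p) {χ : Ctr N M₀ → UT N → ℝ} (hχ01 : ∀ i x, χ i x = 0 ∨ χ i x = 1)
    (hχ : ∀ i x, dist x (ctrU N M₀ i) < M₀ + 1 → χ i x = 1)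
    (h342_1 : ∀ i, HasMajorant (g := toB6 (torusGeom N η L M) R H) (cblk (chart0 N η L M))
      (dirInv (covDT bsrc btgt (fun _ : UT N × Fin d => c₀) Rm ∘ₗ covD bsrc btgt (fun _ : UT N × Fin d => c₀) Rm +
        mulOp q) (χ i ∘ Prod.fst))
      (fun a b => B₀ * η ^ 2 * Real.exp (-(δ₀ * tdist1 N a b))))
    (h342_3 : ∀ i, HasMajorantHom (g := toB6 (torusGeom N η L M) R H) (cblkY (chart0 N η L M))
      (cblk (chart0 N η L M))
      (dirInv (covDT bsrc btgt (fun _ : UT N × Fin d => c₀) Rm ∘ₗ covD bsrc btgt (fun _ : UT N × Fin d => c₀) Rm +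
        mulOp q) (χ i ∘ Prod.fst) ∘ₗ
        covDT bsrc btgt (fun _ : UT N × Fin d => c₀) Rm)
      (fun a b => B₀ * η * Real.exp (-(δ₀ * tdist1 N a b)))) :
    HasMajorantHom (g := toB6 (torusGeom N η L M) R H) (cblkY (chart0 N η L M)) (cblk (chart0 N η L M))
      (Ring.inverse (covDT bsrc btgt (fun _ : UT N × Fin d => c₀) Rm ∘ₗ
          covD bsrc btgt (fun _ : UT N × Fin d => c₀) Rm + mulOp q) ∘ₗ
        covDT bsrc btgt (fun _ : UT N × Fin d => c₀) Rm)
      (fun (a b : UT N) => B₀ * ((5 : ℝ) ^ d + (7 : ℝ) ^ d * Real.exp (δ₀ * ρ) *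
          (d * (|c₀| * (4 * d / (M₀ : ℝ)) * ((2 * ⌊ρ⌋₊ + 1 : ℝ) ^ d * η)))) * B6.c1 d δ₀ α *
        (1 - (7 : ℝ) ^ d * (B₀ * Real.exp (δ₀ * ρ) *
          ((1 + Fintype.card Cp : ℝ) * (|c₀| * (4 * d / (M₀ : ℝ)) * ((2 * ⌊ρ⌋₊ + 1 : ℝ) ^ d * η)) +
            c₀ ^ 2 * (52 * d / (M₀ : ℝ) ^ 2) * η ^ 2)) * B6.c1 d δ₀ α)⁻¹ * η *
        Real.exp (-((1 - 2 * α) * δ₀ * tdist1 N a b))) :=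
  thm37_entry3_l1_dir hM hdiv h2N η L M R H hη c₀ Rm q δ₀ α ρ B₀ hRm hB₀ hδ₀ hα hα2 hρ hsmall hχ
    (hGΩ_pos (fun _ : UT N × Fin d => c₀) Rm hq hχ01) h342_1 h342_3 (hG_pos (fun _ : UT N × Fin d => c₀) Rm hq hχ01) (hinv_pos (fun _ : UT N × Fin d => c₀) Rm hq)

end Capstone

end

end Literature.MathematicalPhysics.QuantumFieldTheory.Balaban1983to89.B9Thm37GlueTorusInv
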